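import Summits.MatrixMultiplication.OmegaCensus.STPPKernelListerOrderN46DP5
import Summits.MatrixMultiplication.OmegaCensus.STPPKernelListerOrderN48DP6
import Summits.MatrixMultiplication.OmegaCensus.STPPKernelListerOrderN51DP10
import Summits.MatrixMultiplication.OmegaCensus.STPPKernelListerFilterBridge

/-!
# ω-census (abelian STPP census): orders `46`, `48`, `51` — the conditional capstones with the N19/N20-dead patterns discharged (kernel)

HONEST FRAMING (pub-omega census; verbatim): lottery ticket; floor = certified bounds/negative ranges.
Census STRUCTURE (seat pub-omega-stpp-2 gen 31, 2026-08-29), family (b2).  The kernel lister's dead lists `deadN46` (5), `deadN48` (14), `deadN51` (15)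
(`…OrderN46DP1/N48DP1/N51DP1.lean`, stpp-2 g30) contain patterns the tree's per-pattern filters kill `H`-generically: N19 (aligned involution clash,
`4 ∤ 46`) kills `234_243`, `224_242_422` at `46`; N20 (aligned order-three clash) kills `224_332_332`, `233_323_332`, `113_232_233_422` at `48` and `234_235`,
`234_325`, `112_121_324_324` at `51` (bridges `notRealizable_of_n19Dead` / `notRealizable_of_n20Dead`, `STPPKernelListerFilterBridge.lean`; each by one
`decide`).  So the conditional capstones hold with the SHORTER residual lists `deadN46r` (3: `234_234`, `234_324`, `223_332_332` — the ℤ₄₇ trio),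
`deadN48r` (11), `deadN51r` (12).  Nothing here is progress on `ω`.

References: M. Kneser, Math. Z. 58 (1953); H. Cohn, R. Kleinberg, B. Szegedy, C. Umans, FOCS 2005 (arXiv:math/0511460), Def. 5.1.
-/

open Finset

namespace Summit.MatrixMultiplication.OmegaCensus.KLister

open Literature.Computability.AlgebraicComplexity
open Summit.MatrixMultiplication.OmegaCensus.CubeNB

/-- Residual dead list at order `46`: `deadN46` minus the 2 patterns killed by the tree filters (`234_243` (N19), `224_242_422` (N19)). [folklore] -/
def deadN46r : List (List Shape) :=
  [[(2, 3, 4), (2, 3, 4)],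
   [(2, 3, 4), (3, 2, 4)],
   [(2, 2, 3), (3, 3, 2), (3, 3, 2)]]

/-- `234_243` is not realisable in any abelian group of order `46` (N19, by `decide`). [cite: Kneser1953] [cite: CohnKleinbergSzegedyUmans2005, Def. 5.1] -/
theorem notRealizable_card46_234_243 {H : Type*} [AddCommGroup H] [Fintype H] [DecidableEq H] (hH : Fintype.card H = 46) :
    ¬ Realizable H ([(2, 3, 4), (2, 4, 3)] : List Shape) :=
  notRealizable_of_n19Dead hH _ (by decide)

/-- `224_242_422` is not realisable in any abelian group of order `46` (N19, by `decide`). [cite: Kneser1953] [cite: CohnKleinbergSzegedyUmans2005, Def. 5.1] -/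
theorem notRealizable_card46_224_242_422 {H : Type*} [AddCommGroup H] [Fintype H] [DecidableEq H] (hH : Fintype.card H = 46) :
    ¬ Realizable H ([(2, 2, 4), (2, 4, 2), (4, 2, 2)] : List Shape) :=
  notRealizable_of_n19Dead hH _ (by decide)

/-- **Order `46` conditional capstone, residual list of 3** (was 5): if no pattern of `deadN46r` is realisable in the abelian group `H` of order `46`, then `H` admits no beating STPP family. [cite: CohnKleinbergSzegedyUmans2005, Def. 5.1] -/
theorem volume_le_of_card_eq_46_of_dead_r {H : Type*} [AddCommGroup H] [Fintype H] [DecidableEq H] (hH : Fintype.card H = 46)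
    (hdead : ∀ D ∈ deadN46r, ¬ Realizable H D)
    {m : ℕ} (A B C : Fin m → Finset H) (hS : IsSTPP A B C) : ∑ i, #(A i) * #(B i) * #(C i) ≤ 46 := by
  refine volume_le_of_card_eq_46_of_dead hH ?_ A B C hS
  intro D hD
  simp only [deadN46, List.mem_cons, List.not_mem_nil, or_false] at hD
  rcases hD with rfl | rfl | rfl | rfl | rfl
  · exact hdead _ (by simp [deadN46r])
  · exact notRealizable_card46_234_243 hH
  · exact hdead _ (by simp [deadN46r])
  · exact hdead _ (by simp [deadN46r])
  · exact notRealizable_card46_224_242_422 hH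

/-- Residual dead list at order `48`: `deadN48` minus the 3 patterns killed by the tree filters (`224_332_332` (N20), `233_323_332` (N20), `113_232_233_422` (N20)). [folklore] -/
def deadN48r : List (List Shape) :=
  [[(2, 3, 3), (2, 4, 4)],
   [(2, 3, 4), (3, 3, 3)],
   [(3, 3, 3), (3, 3, 3)],
   [(1, 1, 1), (2, 3, 3), (2, 3, 5)],
   [(1, 1, 1), (2, 3, 4), (2, 3, 4)],
   [(1, 1, 1), (2, 3, 4), (3, 2, 4)],
   [(2, 2, 3), (2, 5, 2), (3, 3, 2)],
   [(2, 2, 4), (2, 3, 3), (4, 2, 2)],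
   [(2, 2, 4), (2, 4, 2), (5, 2, 2)],
   [(1, 1, 1), (2, 2, 3), (3, 3, 2), (3, 3, 2)],
   [(1, 1, 1), (2, 2, 4), (2, 4, 2), (4, 2, 2)]]

/-- `224_332_332` is not realisable in any abelian group of order `48` (N20, by `decide`). [cite: Kneser1953] [cite: CohnKleinbergSzegedyUmans2005, Def. 5.1] -/
theorem notRealizable_card48_224_332_332 {H : Type*} [AddCommGroup H] [Fintype H] [DecidableEq H] (hH : Fintype.card H = 48) :
    ¬ Realizable H ([(2, 2, 4), (3, 3, 2), (3, 3, 2)] : List Shape) :=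
  notRealizable_of_n20Dead hH _ (by decide)

/-- `233_323_332` is not realisable in any abelian group of order `48` (N20, by `decide`). [cite: Kneser1953] [cite: CohnKleinbergSzegedyUmans2005, Def. 5.1] -/
theorem notRealizable_card48_233_323_332 {H : Type*} [AddCommGroup H] [Fintype H] [DecidableEq H] (hH : Fintype.card H = 48) :
    ¬ Realizable H ([(2, 3, 3), (3, 2, 3), (3, 3, 2)] : List Shape) :=
  notRealizable_of_n20Dead hH _ (by decide)

/-- `113_232_233_422` is not realisable in any abelian group of order `48` (N20, by `decide`). [cite: Kneser1953] [cite: CohnKleinbergSzegedyUmans2005, Def. 5.1] -/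
theorem notRealizable_card48_113_232_233_422 {H : Type*} [AddCommGroup H] [Fintype H] [DecidableEq H] (hH : Fintype.card H = 48) :
    ¬ Realizable H ([(1, 1, 3), (2, 3, 2), (2, 3, 3), (4, 2, 2)] : List Shape) :=
  notRealizable_of_n20Dead hH _ (by decide)

/-- **Order `48` conditional capstone, residual list of 11** (was 14): if no pattern of `deadN48r` is realisable in the abelian group `H` of order `48`, then `H` admits no beating STPP family. [cite: CohnKleinbergSzegedyUmans2005, Def. 5.1] -/
theorem volume_le_of_card_eq_48_of_dead_r {H : Type*} [AddCommGroup H] [Fintype H] [DecidableEq H] (hH : Fintype.card H = 48)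
    (hdead : ∀ D ∈ deadN48r, ¬ Realizable H D)
    {m : ℕ} (A B C : Fin m → Finset H) (hS : IsSTPP A B C) : ∑ i, #(A i) * #(B i) * #(C i) ≤ 48 := by
  refine volume_le_of_card_eq_48_of_dead hH ?_ A B C hS
  intro D hD
  simp only [deadN48, List.mem_cons, List.not_mem_nil, or_false] at hD
  rcases hD with rfl | rfl | rfl | rfl | rfl | rfl | rfl | rfl | rfl | rfl | rfl | rfl | rfl | rfl
  · exact hdead _ (by simp [deadN48r])
  · exact hdead _ (by simp [deadN48r])
  · exact hdead _ (by simp [deadN48r])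
  · exact hdead _ (by simp [deadN48r])
  · exact hdead _ (by simp [deadN48r])
  · exact hdead _ (by simp [deadN48r])
  · exact hdead _ (by simp [deadN48r])
  · exact hdead _ (by simp [deadN48r])
  · exact hdead _ (by simp [deadN48r])
  · exact notRealizable_card48_224_332_332 hH
  · exact notRealizable_card48_233_323_332 hH
  · exact hdead _ (by simp [deadN48r])
  · exact hdead _ (by simp [deadN48r])
  · exact notRealizable_card48_113_232_233_422 hH

/-- Residual dead list at order `51`: `deadN51` minus the 3 patterns killed by the tree filters (`234_235` (N20), `234_325` (N20), `112_121_324_324` (N20)). [folklore] -/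
def deadN51r : List (List Shape) :=
  [[(3, 3, 3), (3, 3, 3)],
   [(1, 1, 1), (2, 3, 4), (3, 3, 3)],
   [(1, 1, 4), (3, 4, 2), (3, 4, 2)],
   [(1, 2, 2), (3, 2, 4), (3, 2, 4)],
   [(2, 2, 4), (2, 3, 3), (2, 3, 3)],
   [(2, 2, 4), (2, 3, 3), (3, 2, 3)],
   [(2, 2, 4), (2, 3, 3), (3, 3, 2)],
   [(2, 2, 4), (3, 3, 2), (3, 3, 2)],
   [(2, 3, 3), (2, 3, 3), (2, 3, 3)],
   [(2, 3, 3), (2, 3, 3), (3, 2, 3)],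
   [(2, 3, 3), (3, 2, 3), (3, 3, 2)],
   [(1, 1, 2), (2, 4, 2), (3, 3, 2), (4, 2, 2)]]

/-- `234_235` is not realisable in any abelian group of order `51` (N20, by `decide`). [cite: Kneser1953] [cite: CohnKleinbergSzegedyUmans2005, Def. 5.1] -/
theorem notRealizable_card51_234_235 {H : Type*} [AddCommGroup H] [Fintype H] [DecidableEq H] (hH : Fintype.card H = 51) :
    ¬ Realizable H ([(2, 3, 4), (2, 3, 5)] : List Shape) :=
  notRealizable_of_n20Dead hH _ (by decide)

/-- `234_325` is not realisable in any abelian group of order `51` (N20, by `decide`). [cite: Kneser1953] [cite: CohnKleinbergSzegedyUmans2005, Def. 5.1] -/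
theorem notRealizable_card51_234_325 {H : Type*} [AddCommGroup H] [Fintype H] [DecidableEq H] (hH : Fintype.card H = 51) :
    ¬ Realizable H ([(2, 3, 4), (3, 2, 5)] : List Shape) :=
  notRealizable_of_n20Dead hH _ (by decide)

/-- `112_121_324_324` is not realisable in any abelian group of order `51` (N20, by `decide`). [cite: Kneser1953] [cite: CohnKleinbergSzegedyUmans2005, Def. 5.1] -/
theorem notRealizable_card51_112_121_324_324 {H : Type*} [AddCommGroup H] [Fintype H] [DecidableEq H] (hH : Fintype.card H = 51) :
    ¬ Realizable H ([(1, 1, 2), (1, 2, 1), (3, 2, 4), (3, 2, 4)] : List Shape) :=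
  notRealizable_of_n20Dead hH _ (by decide)

/-- **Order `51` conditional capstone, residual list of 12** (was 15): if no pattern of `deadN51r` is realisable in the abelian group `H` of order `51`, then `H` admits no beating STPP family. [cite: CohnKleinbergSzegedyUmans2005, Def. 5.1] -/
theorem volume_le_of_card_eq_51_of_dead_r {H : Type*} [AddCommGroup H] [Fintype H] [DecidableEq H] (hH : Fintype.card H = 51)
    (hdead : ∀ D ∈ deadN51r, ¬ Realizable H D)
    {m : ℕ} (A B C : Fin m → Finset H) (hS : IsSTPP A B C) : ∑ i, #(A i) * #(B i) * #(C i) ≤ 51 := by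
  refine volume_le_of_card_eq_51_of_dead hH ?_ A B C hS
  intro D hD
  simp only [deadN51, List.mem_cons, List.not_mem_nil, or_false] at hD
  rcases hD with rfl | rfl | rfl | rfl | rfl | rfl | rfl | rfl | rfl | rfl | rfl | rfl | rfl | rfl | rfl
  · exact notRealizable_card51_234_235 hH
  · exact notRealizable_card51_234_325 hH
  · exact hdead _ (by simp [deadN51r])
  · exact hdead _ (by simp [deadN51r])
  · exact hdead _ (by simp [deadN51r])
  · exact hdead _ (by simp [deadN51r])
  · exact hdead _ (by simp [deadN51r])
  · exact hdead _ (by simp [deadN51r])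
  · exact hdead _ (by simp [deadN51r])
  · exact hdead _ (by simp [deadN51r])
  · exact hdead _ (by simp [deadN51r])
  · exact hdead _ (by simp [deadN51r])
  · exact hdead _ (by simp [deadN51r])
  · exact notRealizable_card51_112_121_324_324 hH
  · exact hdead _ (by simp [deadN51r])

end Summit.MatrixMultiplication.OmegaCensus.KLister
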